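import Summits.Parity.GeneralizedHardyLittlewood.Theorems.LeeYangFibresAbsoluteUpgradeUniformDefs
import Summits.Parity.GeneralizedHardyLittlewood.Theorems.LeeYangFibresRelativeDimOneDegenerateCount
import Summits.Parity.GeneralizedHardyLittlewood.Theorems.LeeYangFibresRelativeDimOneSingularMeanGlueAux2
import Summits.Parity.GeneralizedHardyLittlewood.Theorems.LeeYangFibresRelativeDimOneLocalAverage
import Summits.Parity.GeneralizedHardyLittlewood.Theorems.LeeYangFibresCellParityLawSingularRatio
import Literature.NumberTheory.Sieve.LinearEquationsInPrimesSingularSeries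
import Literature.NumberTheory.Sieve.LinearEquationsInPrimesProofs
import Mathlib.Analysis.PSeries
import HarnessLib

/-!
# Route `LeeYangFibres`, crux `AbsoluteUpgrade` (stmt-Parity-14116), line `Sketch` (uniform amplification):
# pointwise facts for the glue `stub_uniformSingularMeanGlue` (part 1)

Sorry-free auxiliary facts over the vocabulary `LeeYangFibresAbsoluteUpgradeUniformDefs.lean`, used by
`LeeYangFibresAbsoluteUpgradeUniformSingularMeanGlue.lean` (the m-UNIFORM Gallagher average of the main terms
of the translate-constellations `Ψ^{(H)}`):

* Step 1, the window factorisation `∏_{p ≤ x} β_p(Φ) = (∏_{p ≤ y} β_p(Φ)) · ∏_{y < p ≤ x} β_p(Φ)`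
  (`singularProductPartial_eq_mul_prod_primeWindow`), and its consequence that a vanishing truncated
  product kills the singular product (`singularProduct_eq_zero_of_partial_eq_zero`,
  `singularProductPartial_translateFamily_eq_zero`);
* Step 2, at a prime `p > y` (so `p ∤ a_i`), the exact local identity of `LocalRatioFacts` in sandwich form
  `β_p(Ψ)^{m+1} r_p ≤ β_p(Ψ^{(H)}) ≤ β_p(Ψ)^{m+1} (1 + collisionCount(H,p)/(p − T))` with
  `0 < r_p ≤ 1`, `1 − r_p ≤ T²/p²` (`localFactor_translateFamily_sandwich`);
* Step 3, the product over the window `(y, x]`: `1 − T²/y ≤ ∏ r_p` and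
  `∏ (1 + c_p) = ∑_{Q ⊆ window} ∏_{p ∈ Q} c_p`, split into `Q = ∅`, the medium moduli `∏ Q ≤ √N`
  and the tail moduli `∏ Q > √N` (`prod_primeWindow_sandwich`, `sum_powerset_split`,
  `translate_sandwich` — the registered sub-goal of this file; the helpers live in the sub-namespace `GlueProof`).

References: P. X. Gallagher, Mathematika 23 (1976), §2 [Gallagher1976]; B. Green, T. Tao, Ann. of Math. 171
(2010), (1.6), Lemma 1.3 [GreenTao2010].
-/

noncomputable section

open scoped BigOperators Classical Topology
open Finset Filter MeasureTheory Literature.NumberTheory.Sieve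
open Summit.Parity.GeneralizedHardyLittlewood.Cruxes.RelativeDimOne.TranslateAmplification

namespace Summit.Parity.GeneralizedHardyLittlewood.Cruxes.AbsoluteUpgrade.UniformAmplification

open CellParityLaw.SectionAnnihilator.SingularRatio (singularProductPartial_nonneg)

namespace GlueProof

variable {t m : ℕ}

/-! ### Step 1: the window factorisation -/

/-- The primes of `(y, x]` are the primes `≤ x` that are not `≤ y`. [folklore] -/
theorem primesLE_sdiff_primesLE (y x : ℕ) : Nat.primesLE x \ Nat.primesLE y = primeWindow y x := by
  ext p
  simp only [Finset.mem_sdiff, Nat.mem_primesLE, primeWindow, Finset.mem_filter, Finset.mem_Ioc,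
    not_and]
  constructor
  · rintro ⟨⟨hpx, hp⟩, h⟩
    exact ⟨⟨lt_of_not_ge fun h' => h h' hp, hpx⟩, hp⟩
  · rintro ⟨⟨hyp, hpx⟩, hp⟩
    exact ⟨⟨hpx, hp⟩, fun h' _ => absurd h' (not_le.mpr hyp)⟩

/-- Membership in the prime window `(y, x]`. [folklore] -/
theorem mem_primeWindow {y x p : ℕ} : p ∈ primeWindow y x ↔ p.Prime ∧ y < p ∧ p ≤ x := by
  simp only [primeWindow, Finset.mem_filter, Finset.mem_Ioc]
  tauto

/-- **Window factorisation**: `∏_{p ≤ x} β_p = (∏_{p ≤ y} β_p) · ∏_{y < p ≤ x} β_p` for `y ≤ x`. [folklore] -/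
theorem singularProductPartial_eq_mul_prod_primeWindow {d s : ℕ} (Φ : Fin s → AffLinForm d) {y x : ℕ}
    (hyx : y ≤ x) :
    singularProductPartial Φ x = singularProductPartial Φ y * ∏ p ∈ primeWindow y x, localFactor Φ p := by
  unfold singularProductPartial
  rw [← primesLE_sdiff_primesLE, mul_comm, Finset.prod_sdiff (Nat.primesLE_mono hyx)]

/-- If a truncated product `∏_{p ≤ y} β_p(Φ)` vanishes, so does the singular product of the non-degenerate
system `Φ` (all later partial products vanish; Lemma 1.3 gives the limit). [cite: GreenTao2010, Lemma 1.3] -/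
theorem singularProduct_eq_zero_of_partial_eq_zero {d s : ℕ} {Φ : Fin s → AffLinForm d}
    (hΦ : IsNondegenerateSystem Φ) {y : ℕ} (h : singularProductPartial Φ y = 0) : singularProduct Φ = 0 :=
  tendsto_nhds_unique (tendsto_singularProductPartial_holds d s Φ hΦ)
    (tendsto_const_nhds.congr' (Filter.eventually_atTop.mpr ⟨y, fun x hx => by
      rw [singularProductPartial_eq_mul_prod_primeWindow Φ hx, h, zero_mul]⟩))

/-- If `∏_{p ≤ y} β_p(Ψ) = 0` then `∏_{p ≤ y} β_p(Ψ^{(H)}) = 0` for EVERY shift `H`: the non-negative truncated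
products of the translate-constellations average exactly to `P^m (∏_{p ≤ y} β_p(Ψ))^{m+1} = 0` over the
primorial cube at `H` (`LocalAverage`). [cite: Gallagher1976, Section 2] -/
theorem singularProductPartial_translateFamily_eq_zero (Ψ : Fin t → AffLinForm 1) {y : ℕ}
    (h0 : singularProductPartial Ψ y = 0) (H : Fin m → ℤ) :
    singularProductPartial (translateFamily Ψ H) y = 0 := by
  have h := localAverage_primorial stub_localAverage m Ψ y H
  rw [h0, zero_pow (Nat.succ_ne_zero m), mul_zero] at h
  have hP : (0 : ℤ) < ((primorial y : ℕ) : ℤ) := by exact_mod_cast primorial_pos y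
  have hmem : H ∈ Fintype.piFinset (fun j : Fin m => Finset.Ico (H j) (H j + ((primorial y : ℕ) : ℤ))) :=
    Fintype.mem_piFinset.mpr fun j => Finset.mem_Ico.mpr ⟨le_rfl, by linarith⟩
  exact (Finset.sum_eq_zero_iff_of_nonneg fun K _ =>
    singularProductPartial_nonneg (translateFamily Ψ K) y).mp h H hmem

/-! ### Step 2: the local identity at a prime of the window -/

/-- No prime `p > L ≥ ‖Ψ‖_N` divides a leading coefficient of the non-degenerate `d = 1` system `Ψ`
(`0 < |a_i| ≤ L < p`). [folklore] -/
theorem not_dvd_coeff_of_lt {Ψ : Fin t → AffLinForm 1} (hΨ : IsNondegenerateSystem Ψ) {N L : ℕ}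
    (hL : affLinSize Ψ N ≤ L) {p : ℕ} (hLp : L < p) (i : Fin t) : ¬ (p : ℤ) ∣ (Ψ i).coeff 0 := by
  intro h
  have h0 := coeff_zero_ne_zero hΨ i
  have h1 : p ∣ ((Ψ i).coeff 0).natAbs := Int.natCast_dvd.mp h
  have h2 : p ≤ ((Ψ i).coeff 0).natAbs := Nat.le_of_dvd (Int.natAbs_pos.mpr h0) h1
  have h3 := natAbs_coeff_le_of_affLinSize_le hL i 0
  omega

/-- The algebra of the local identity: with `ν_H = (m+1)ν − d`,
`(1 − ν/p)^{m+1} · r_p · (1 + d/(p − (m+1)ν)) = 1 − ν_H/p`, `r_p = (p − (m+1)ν) p^m/(p − ν)^{m+1}`. [folklore] -/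
theorem genericRatio_identity {p ν νH : ℝ} {m : ℕ} (hp : p ≠ 0) (hν : p - ν ≠ 0)
    (hmν : p - (m + 1) * ν ≠ 0) :
    (1 - ν / p) ^ (m + 1) * ((p - (m + 1) * ν) * p ^ m / (p - ν) ^ (m + 1)) *
        (1 + ((m + 1) * ν - νH) / (p - (m + 1) * ν)) = 1 - νH / p := by
  rw [one_sub_div hp, one_sub_div hp, div_pow, one_add_div hmν,
    show p - (m + 1) * ν + ((m + 1) * ν - νH) = p - νH by ring, div_mul_div_comm, div_mul_div_comm,
    div_eq_div_iff (mul_ne_zero (mul_ne_zero (pow_ne_zero _ hp) (pow_ne_zero _ hν)) hmν) hp]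
  ring

/-- **Step 2** (from `LocalRatioFacts`). At a prime `p ≥ 2T`, `T = (m+1)t`, not dividing the leading
coefficients: `β_p(Ψ)^{m+1} r_p ≤ β_p(Ψ^{(H)}) ≤ β_p(Ψ)^{m+1} (1 + collisionCount(H,p)/(p − T))`, where the
generic ratio `r_p = genericRatio m ν_p(Ψ) p` satisfies `0 < r_p ≤ 1` and `1 − r_p ≤ T²/p²`
(`β_p(Ψ^{(H)}) = β_p(Ψ)^{m+1} r_p (1 + d/(p − (m+1)ν))` with `0 ≤ d = (m+1)ν − ν_H ≤ collisionCount`).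
[cite: Gallagher1976, Section 2] -/
theorem localFactor_translateFamily_sandwich (hA : LocalRatioFacts) (ht : 1 ≤ t) (Ψ : Fin t → AffLinForm 1)
    (H : Fin m → ℤ) {p : ℕ} (hp : p.Prime) (hcoef : ∀ i, ¬ (p : ℤ) ∣ (Ψ i).coeff 0)
    (hpT : 2 * ((m + 1) * t) ≤ p) :
    localFactor Ψ p ^ (m + 1) * genericRatio m (rootClassCount Ψ p) p ≤ localFactor (translateFamily Ψ H) p ∧
    localFactor (translateFamily Ψ H) p ≤
      localFactor Ψ p ^ (m + 1) * (1 + (collisionCount Ψ H p : ℝ) / ((p : ℝ) - ((m + 1) * t : ℕ))) ∧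
    0 < genericRatio m (rootClassCount Ψ p) p ∧ genericRatio m (rootClassCount Ψ p) p ≤ 1 ∧
    1 - genericRatio m (rootClassCount Ψ p) p ≤ (((m + 1) * t : ℕ) : ℝ) ^ 2 / (p : ℝ) ^ 2 := by
  obtain ⟨h1, h2, h3, h4, h5⟩ := hA
  have hν := h4 t p Ψ hp hcoef ht
  have h2' := h2 t m p Ψ H hp hcoef
  have h3' := h3 t m p Ψ H hp hcoef
  have hνT : (m + 1) * rootClassCount Ψ p ≤ (m + 1) * t := Nat.mul_le_mul_left _ hν.2
  have h5' := h5 m (rootClassCount Ψ p) p hp.pos (le_trans (Nat.mul_le_mul_left 2 hνT) hpT)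
  set ν : ℕ := rootClassCount Ψ p with hνdef
  set νH : ℕ := rootClassCount (translateFamily Ψ H) p with hνHdef
  set cc : ℕ := collisionCount Ψ H p with hccdef
  -- real-number facts
  have hT1 : 1 ≤ (m + 1) * t := le_trans ht (Nat.le_mul_of_pos_left t (Nat.succ_pos m))
  have hTp : (((m + 1) * t : ℕ) : ℝ) + 1 ≤ p := by
    have : (m + 1) * t + 1 ≤ p := by omega
    exact_mod_cast this
  have hTcast : (((m + 1) * t : ℕ) : ℝ) = ((m : ℝ) + 1) * t := by push_cast; ring
  have hνTr : ((m : ℝ) + 1) * ν ≤ (((m + 1) * t : ℕ) : ℝ) := by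
    have := (Nat.cast_le (α := ℝ)).mpr hνT
    push_cast at this
    rw [hTcast]
    exact this
  have hp0 : (0 : ℝ) < p := by exact_mod_cast hp.pos
  have hmν0 : (0 : ℝ) ≤ m * ν := by positivity
  have hden1 : (0 : ℝ) < p - ((m : ℝ) + 1) * ν := by linarith
  have hden2 : (0 : ℝ) < p - ν := by linarith
  have hden3 : (0 : ℝ) < p - (((m + 1) * t : ℕ) : ℝ) := by linarith
  -- the identity
  have hβ : localFactor Ψ p = ((p : ℝ) / ((p : ℝ) - 1)) ^ t * (1 - (ν : ℝ) / p) := h1 t p Ψ hp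
  have hβH : localFactor (translateFamily Ψ H) p =
      ((p : ℝ) / ((p : ℝ) - 1)) ^ ((m + 1) * t) * (1 - (νH : ℝ) / p) := h1 ((m + 1) * t) p _ hp
  have hid : localFactor (translateFamily Ψ H) p =
      localFactor Ψ p ^ (m + 1) * genericRatio m ν p *
        (1 + (((m : ℝ) + 1) * ν - νH) / ((p : ℝ) - ((m : ℝ) + 1) * ν)) := by
    rw [hβH, hβ, mul_pow, ← pow_mul, mul_comm t (m + 1), genericRatio,
      ← genericRatio_identity (νH := (νH : ℝ)) hp0.ne' hden2.ne' hden1.ne']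
    ring
  -- the defect
  have hd0 : (0 : ℝ) ≤ ((m : ℝ) + 1) * ν - νH := by
    have := (Nat.cast_le (α := ℝ)).mpr h2'
    push_cast at this
    linarith
  have hdc : ((m : ℝ) + 1) * ν - νH ≤ cc := by
    have := (Nat.cast_le (α := ℝ)).mpr h3'
    push_cast at this
    linarith
  have he0 : 0 ≤ (((m : ℝ) + 1) * ν - νH) / ((p : ℝ) - ((m : ℝ) + 1) * ν) := div_nonneg hd0 hden1.le
  have hec : (((m : ℝ) + 1) * ν - νH) / ((p : ℝ) - ((m : ℝ) + 1) * ν) ≤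
      (cc : ℝ) / ((p : ℝ) - ((m + 1) * t : ℕ)) :=
    div_le_div₀ (Nat.cast_nonneg cc) hdc hden3 (by linarith)
  have hβm0 : 0 ≤ localFactor Ψ p ^ (m + 1) := pow_nonneg (localFactor_nonneg Ψ p) _
  refine ⟨?_, ?_, h5'.1, h5'.2.1, h5'.2.2.trans ?_⟩
  · rw [hid]
    exact le_mul_of_one_le_right (mul_nonneg hβm0 h5'.1.le) (by linarith)
  · rw [hid]
    calc localFactor Ψ p ^ (m + 1) * genericRatio m ν p *
          (1 + (((m : ℝ) + 1) * ν - νH) / ((p : ℝ) - ((m : ℝ) + 1) * ν))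
        ≤ localFactor Ψ p ^ (m + 1) * 1 * (1 + (cc : ℝ) / ((p : ℝ) - ((m + 1) * t : ℕ))) :=
          mul_le_mul (mul_le_mul_of_nonneg_left h5'.2.1 hβm0) (by linarith) (by linarith)
            (by rw [mul_one]; exact hβm0)
      _ = _ := by rw [mul_one]
  · exact div_le_div_of_nonneg_right (pow_le_pow_left₀ (Nat.cast_nonneg _) (Nat.cast_le.mpr hνT) 2)
      (by positivity)

/-! ### Step 3: the product over the window -/

/-- `1 − ∑_s (1 − r_p) ≤ ∏_s r_p` for ratios `r_p ∈ [0, 1]` (Weierstrass product inequality, in the form used for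
the generic ratios of the window). [folklore] -/
theorem one_sub_sum_one_sub_le_prod {ι : Type*} (s : Finset ι) (r : ι → ℝ)
    (hr : ∀ i ∈ s, 0 ≤ r i ∧ r i ≤ 1) : 1 - ∑ i ∈ s, (1 - r i) ≤ ∏ i ∈ s, r i := by
  induction s using Finset.induction_on with
  | empty => simp
  | insert a s ha ih =>
    rw [Finset.sum_insert ha, Finset.prod_insert ha]
    have hra := hr a (Finset.mem_insert_self a s)
    have hr' : ∀ i ∈ s, 0 ≤ r i ∧ r i ≤ 1 := fun i hi => hr i (Finset.mem_insert_of_mem hi)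
    have hs0 : 0 ≤ ∑ i ∈ s, (1 - r i) := Finset.sum_nonneg fun i hi => by linarith [(hr' i hi).2]
    have h1 : r a * (1 - ∑ i ∈ s, (1 - r i)) ≤ r a * ∏ i ∈ s, r i :=
      mul_le_mul_of_nonneg_left (ih hr') hra.1
    nlinarith [mul_nonneg (sub_nonneg.mpr hra.2) hs0]

/-- **Step 3** (product of Step 2 over the primes of the window `(y, x]`, `y > L`, `y ≥ 2T`, `y ≥ 1`):
`(∏_{y<p≤x} β_p(Ψ))^{m+1} (1 − T²/y) ≤ ∏_{y<p≤x} β_p(Ψ^{(H)}) ≤ (∏_{y<p≤x} β_p(Ψ))^{m+1} ∑_{Q ⊆ window} ∏_{p∈Q} c_p(H)`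
with `c_p(H) = collisionCount(H,p)/(p − T)` (`∏ r_p ≥ 1 − ∑ (1 − r_p) ≥ 1 − T² ∑_{n > y} n⁻² ≥ 1 − T²/y`, `one_sub_sum_one_sub_le_prod`, and
`∏ (1 + c_p) = ∑_Q ∏_{p ∈ Q} c_p`). [cite: Gallagher1976, Section 2] -/
theorem prod_primeWindow_sandwich (hA : LocalRatioFacts) (ht : 1 ≤ t) {Ψ : Fin t → AffLinForm 1}
    (hΨ : IsNondegenerateSystem Ψ) {N L : ℕ} (hL : affLinSize Ψ N ≤ L) (H : Fin m → ℤ) {y x : ℕ}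
    (hy : 1 ≤ y) (hLy : L < y) (hTy : 2 * ((m + 1) * t) ≤ y) (hyx : y ≤ x) :
    (∏ p ∈ primeWindow y x, localFactor Ψ p) ^ (m + 1) * (1 - (((m + 1) * t : ℕ) : ℝ) ^ 2 / y) ≤
        ∏ p ∈ primeWindow y x, localFactor (translateFamily Ψ H) p ∧
      ∏ p ∈ primeWindow y x, localFactor (translateFamily Ψ H) p ≤
        (∏ p ∈ primeWindow y x, localFactor Ψ p) ^ (m + 1) *
          ∑ Q ∈ (primeWindow y x).powerset,
            ∏ p ∈ Q, (collisionCount Ψ H p : ℝ) / ((p : ℝ) - ((m + 1) * t : ℕ)) := by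
  set W := primeWindow y x with hW
  have hloc : ∀ p ∈ W,
      localFactor Ψ p ^ (m + 1) * genericRatio m (rootClassCount Ψ p) p ≤ localFactor (translateFamily Ψ H) p ∧
      localFactor (translateFamily Ψ H) p ≤
        localFactor Ψ p ^ (m + 1) * (1 + (collisionCount Ψ H p : ℝ) / ((p : ℝ) - ((m + 1) * t : ℕ))) ∧
      0 < genericRatio m (rootClassCount Ψ p) p ∧ genericRatio m (rootClassCount Ψ p) p ≤ 1 ∧
      1 - genericRatio m (rootClassCount Ψ p) p ≤ (((m + 1) * t : ℕ) : ℝ) ^ 2 / (p : ℝ) ^ 2 := fun p hp => by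
    obtain ⟨hpr, hyp, _⟩ := mem_primeWindow.mp hp
    exact localFactor_translateFamily_sandwich hA ht Ψ H hpr
      (fun i => not_dvd_coeff_of_lt hΨ hL (lt_trans hLy hyp) i) (by omega)
  have hPi0 : 0 ≤ ∏ p ∈ W, localFactor Ψ p := Finset.prod_nonneg fun p _ => localFactor_nonneg Ψ p
  constructor
  · have hprod : ∏ p ∈ W, (localFactor Ψ p ^ (m + 1) * genericRatio m (rootClassCount Ψ p) p) ≤
        ∏ p ∈ W, localFactor (translateFamily Ψ H) p :=
      Finset.prod_le_prod (fun p hp => mul_nonneg (pow_nonneg (localFactor_nonneg Ψ p) _)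
        (hloc p hp).2.2.1.le) (fun p hp => (hloc p hp).1)
    rw [Finset.prod_mul_distrib, Finset.prod_pow] at hprod
    refine le_trans (mul_le_mul_of_nonneg_left ?_ (pow_nonneg hPi0 _)) hprod
    have hsum : ∑ p ∈ W, (1 - genericRatio m (rootClassCount Ψ p) p) ≤
        (((m + 1) * t : ℕ) : ℝ) ^ 2 / y := by
      have hy0 : (0 : ℝ) < y := by exact_mod_cast hy
      calc ∑ p ∈ W, (1 - genericRatio m (rootClassCount Ψ p) p)
          ≤ ∑ p ∈ W, (((m + 1) * t : ℕ) : ℝ) ^ 2 / (p : ℝ) ^ 2 :=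
            Finset.sum_le_sum fun p hp => (hloc p hp).2.2.2.2
        _ = (((m + 1) * t : ℕ) : ℝ) ^ 2 * ∑ p ∈ W, ((p : ℝ) ^ 2)⁻¹ := by
            rw [Finset.mul_sum]
            exact Finset.sum_congr rfl fun p _ => by rw [div_eq_mul_inv]
        _ ≤ (((m + 1) * t : ℕ) : ℝ) ^ 2 * ∑ n ∈ Finset.Ioc y x, ((n : ℝ) ^ 2)⁻¹ := by
            refine mul_le_mul_of_nonneg_left (Finset.sum_le_sum_of_subset_of_nonneg
              (fun p hp => Finset.mem_Ioc.mpr (mem_primeWindow.mp hp).2) fun n _ _ => by positivity)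
              (by positivity)
        _ ≤ (((m + 1) * t : ℕ) : ℝ) ^ 2 * ((y : ℝ)⁻¹ - (x : ℝ)⁻¹) :=
            mul_le_mul_of_nonneg_left (sum_Ioc_inv_sq_le_sub (by omega) hyx) (by positivity)
        _ ≤ (((m + 1) * t : ℕ) : ℝ) ^ 2 / y := by
            rw [div_eq_mul_inv]
            have hx0 : (0 : ℝ) ≤ (x : ℝ)⁻¹ := inv_nonneg.mpr (Nat.cast_nonneg x)
            exact mul_le_mul_of_nonneg_left (by linarith) (by positivity)
    calc 1 - (((m + 1) * t : ℕ) : ℝ) ^ 2 / y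
        ≤ 1 - ∑ p ∈ W, (1 - genericRatio m (rootClassCount Ψ p) p) := by linarith
      _ ≤ ∏ p ∈ W, genericRatio m (rootClassCount Ψ p) p :=
          one_sub_sum_one_sub_le_prod W _ fun p hp => ⟨(hloc p hp).2.2.1.le, (hloc p hp).2.2.2.1⟩
  · calc ∏ p ∈ W, localFactor (translateFamily Ψ H) p
        ≤ ∏ p ∈ W, (localFactor Ψ p ^ (m + 1) *
            (1 + (collisionCount Ψ H p : ℝ) / ((p : ℝ) - ((m + 1) * t : ℕ)))) :=
          Finset.prod_le_prod (fun p _ => localFactor_nonneg _ p) fun p hp => (hloc p hp).2.1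
      _ = (∏ p ∈ W, localFactor Ψ p) ^ (m + 1) *
            ∏ p ∈ W, (1 + (collisionCount Ψ H p : ℝ) / ((p : ℝ) - ((m + 1) * t : ℕ))) := by
          rw [Finset.prod_mul_distrib, Finset.prod_pow]
      _ = _ := by rw [Finset.prod_one_add]

/-- Splitting a sum over the subsets `Q` of a finite set of naturals according to `Q = ∅`, `Q ≠ ∅` with
`∏ Q ≤ s`, and `∏ Q > s` (`s ≥ 1`, so that `∏ ∅ = 1 ≤ s`). [folklore] -/
theorem sum_powerset_split (W : Finset ℕ) (g : Finset ℕ → ℝ) {s : ℕ} (hs : 1 ≤ s) :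
    ∑ Q ∈ W.powerset, g Q =
      g ∅ + ∑ Q ∈ W.powerset.filter (fun Q => Q.Nonempty ∧ ∏ p ∈ Q, p ≤ s), g Q +
        ∑ Q ∈ W.powerset.filter (fun Q => s < ∏ p ∈ Q, p), g Q := by
  rw [← Finset.sum_filter_add_sum_filter_not W.powerset (fun Q => s < ∏ p ∈ Q, p),
    ← Finset.sum_filter_add_sum_filter_not (W.powerset.filter fun Q => ¬ (s < ∏ p ∈ Q, p))
      (fun Q => Q.Nonempty), Finset.filter_filter, Finset.filter_filter]
  have h1 : W.powerset.filter (fun Q => ¬ (s < ∏ p ∈ Q, p) ∧ Q.Nonempty) =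
      W.powerset.filter (fun Q => Q.Nonempty ∧ ∏ p ∈ Q, p ≤ s) :=
    Finset.filter_congr fun Q _ => by rw [not_lt, and_comm]
  have h2 : W.powerset.filter (fun Q => ¬ (s < ∏ p ∈ Q, p) ∧ ¬ Q.Nonempty) = {∅} := by
    ext Q
    simp only [Finset.mem_filter, Finset.mem_powerset, Finset.mem_singleton,
      Finset.not_nonempty_iff_eq_empty, not_lt]
    constructor
    · rintro ⟨_, _, rfl⟩
      rfl
    · rintro rfl
      exact ⟨Finset.empty_subset _, by rw [Finset.prod_empty]; exact hs, rfl⟩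
  rw [h1, h2, Finset.sum_singleton]
  ring

end GlueProof

open GlueProof in
/-- **The pointwise sandwich for a shift `H`** (registered sub-goal of this file): for `1 ≤ y ≤ x`, `y > L`,
`y ≥ 2T` (`T = (m+1)t`), `N ≥ 1`, writing `S_x(Φ) = ∏_{p ≤ x} β_p(Φ)`,
`(1 − T²/y) S_x(Ψ)^{m+1} S_y(Ψ^{(H)}) ≤ S_y(Ψ)^{m+1} S_x(Ψ^{(H)}) ≤ S_x(Ψ)^{m+1} S_y(Ψ^{(H)}) (1 + med_x(H) + tail_x(H))`,
where `med_x(H)`, `tail_x(H)` are the sums of `∏_{p ∈ Q} collisionCount(H,p)/(p − T)` over the non-empty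
`Q ⊆ primes(y, x]` with `∏ Q ≤ √N`, resp. `∏ Q > √N` (the inner sums of `MediumCollisions` / `TailCollisions`).
[cite: Gallagher1976, Section 2] -/
theorem translate_sandwich : ∀ (t m N L y x : ℕ) (Ψ : Fin t → AffLinForm 1) (H : Fin m → ℤ), LocalRatioFacts → 1 ≤ t → IsNondegenerateSystem Ψ → 1 ≤ N → affLinSize Ψ N ≤ L → 1 ≤ y → L < y → 2 * ((m + 1) * t) ≤ y → y ≤ x → (1 - (((m + 1) * t : ℕ) : ℝ) ^ 2 / y) * singularProductPartial Ψ x ^ (m + 1) * singularProductPartial (translateFamily Ψ H) y ≤ singularProductPartial Ψ y ^ (m + 1) * singularProductPartial (translateFamily Ψ H) x ∧ singularProductPartial Ψ y ^ (m + 1) * singularProductPartial (translateFamily Ψ H) x ≤ singularProductPartial Ψ x ^ (m + 1) * singularProductPartial (translateFamily Ψ H) y * (1 + ∑ Q ∈ ((primeWindow y x).powerset).filter (fun Q => Q.Nonempty ∧ ∏ p ∈ Q, p ≤ Nat.sqrt N), ∏ p ∈ Q, (collisionCount Ψ H p : ℝ) / ((p : ℝ) - ((m + 1) * t : ℕ))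 + ∑ Q ∈ ((primeWindow y x).powerset).filter (fun Q => Nat.sqrt N < ∏ p ∈ Q, p), ∏ p ∈ Q, (collisionCount Ψ H p : ℝ) / ((p : ℝ) - ((m + 1) * t : ℕ))) := by
  intro t m N L y x Ψ H hA ht hΨ hN hL hy hLy hTy hyx
  obtain ⟨hlo, hup⟩ := prod_primeWindow_sandwich hA ht hΨ hL H hy hLy hTy hyx
  have hsplit := sum_powerset_split (primeWindow y x)
    (fun Q => ∏ p ∈ Q, (collisionCount Ψ H p : ℝ) / ((p : ℝ) - ((m + 1) * t : ℕ))) (Nat.sqrt_pos.mpr hN)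
  rw [Finset.prod_empty] at hsplit
  rw [hsplit] at hup
  have hF0 : 0 ≤ singularProductPartial Ψ y := singularProductPartial_nonneg Ψ y
  have hFH : 0 ≤ singularProductPartial (translateFamily Ψ H) y := singularProductPartial_nonneg _ y
  have hPi0 : 0 ≤ ∏ p ∈ primeWindow y x, localFactor Ψ p :=
    Finset.prod_nonneg fun p _ => localFactor_nonneg Ψ p
  rw [singularProductPartial_eq_mul_prod_primeWindow Ψ hyx,
    singularProductPartial_eq_mul_prod_primeWindow (translateFamily Ψ H) hyx, mul_pow]
  constructor
  · calc (1 - (((m + 1) * t : ℕ) : ℝ) ^ 2 / y) *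
          (singularProductPartial Ψ y ^ (m + 1) * (∏ p ∈ primeWindow y x, localFactor Ψ p) ^ (m + 1)) *
          singularProductPartial (translateFamily Ψ H) y
        = singularProductPartial Ψ y ^ (m + 1) * singularProductPartial (translateFamily Ψ H) y *
            ((∏ p ∈ primeWindow y x, localFactor Ψ p) ^ (m + 1) *
              (1 - (((m + 1) * t : ℕ) : ℝ) ^ 2 / y)) := by ring
      _ ≤ singularProductPartial Ψ y ^ (m + 1) * singularProductPartial (translateFamily Ψ H) y *
            ∏ p ∈ primeWindow y x, localFactor (translateFamily Ψ H) p :=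
          mul_le_mul_of_nonneg_left hlo (mul_nonneg (pow_nonneg hF0 _) hFH)
      _ = _ := by ring
  · calc singularProductPartial Ψ y ^ (m + 1) *
          (singularProductPartial (translateFamily Ψ H) y *
            ∏ p ∈ primeWindow y x, localFactor (translateFamily Ψ H) p)
        = singularProductPartial Ψ y ^ (m + 1) * singularProductPartial (translateFamily Ψ H) y *
            ∏ p ∈ primeWindow y x, localFactor (translateFamily Ψ H) p := by ring
      _ ≤ singularProductPartial Ψ y ^ (m + 1) * singularProductPartial (translateFamily Ψ H) y *
            ((∏ p ∈ primeWindow y x, localFactor Ψ p) ^ (m + 1) * _) :=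
          mul_le_mul_of_nonneg_left hup (mul_nonneg (pow_nonneg hF0 _) hFH)
      _ = _ := by ring

end Summit.Parity.GeneralizedHardyLittlewood.Cruxes.AbsoluteUpgrade.UniformAmplification

end
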